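import Literature.Topology.FourManifolds.TubeComplementDuality
import Literature.Topology.FourManifolds.SphereProductCohomology
import Literature.Topology.FourManifolds.PuncturedTubeMiddleHomology
import HarnessLib

/-!
# The isotropy `(ISO)` of the torus of a spherical modification in the middle dimension
# (Kervaire–Milnor, Lemma 5.8: the input from Thom's theorem), `k` even

Topic `Literature/Topology/FourManifolds`; sequel of `TubeComplementDuality.lean` and the last
geometric input for Kervaire–Milnor's **Lemma 5.8** (*Groups of homotopy spheres I*, Ann. of Math.
(2) 77 (1963), pp. 516–518) in the reduced form `(ISO)` of `SphereSurgeryOddMiddleRank.lean`, for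
the fact seat of
`Literature.Topology.FourManifolds.HomotopySphere.boundsContractible_of_nullCobordism_isStablyParallelizable_four`
(Thm. 5.1 at `k = 2`). Everything here is **proved**; no definition and no named fact is
introduced (D-0026).

For a framed sphere `φ : Sᵏ × ℝᵏ⁺¹ ↪ W` (`k ≥ 2` EVEN) in a compact simply connected smooth
`(2k+1)`-manifold `W` with `Hᵏ(∂W; ℤ) = 0`, with parallel `ε : u ↦ φ(u, v₀)` and meridian
`ε' : v ↦ φ(u₀, v/2)` in `W ∖ S` (Kervaire–Milnor p. 516: `ε`, `ε'`), we prove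

* `FramedSphereFamily.mul_eq_zero_of_zsmul_parallel_eq_zsmul_meridian` — **`(ISO)`: if
  `m ε⁎θ = m' ε'⁎θ` in `Hₖ(W ∖ S; ℤ)` then `m m' = 0`.**

Kervaire–Milnor prove Lemma 5.8 through the semi-characteristic of the `(2k+2)`-dimensional
trace of the modification (Lemma 5.9, pp. 517–518). The tree has no such trace manifold, and the
parity input `(ISO)` is obtained here by a different classical route, R. Thom's isotropy theorem
for the manifold with boundary `M₀ = M ∖ Interior φ(Sᵏ × Dᵏ⁺¹)` of Lemma 5.6 (p. 514) (Thom 1952,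
Thm. V.10: the classes of `∂M₀ ⊇ Sᵏ × Sᵏ` bounding in `M₀` are isotropic for the intersection
form), combined with `ε · ε' = ±1`, `ε · ε = ε' · ε' = 0` on the torus, which give `2 m m' = 0`
for `k` even. Concretely: push the relation into `X = ExtCollar W ∖ incl S`; the class `x = m ε_A − m' ε'_A ∈ Hₖ(A)` of the punctured
half-tube `A ≃ Sᵏ × Sᵏ` dies in `X`, so by
`FramedSphereFamily.exists_eq_capProduct_and_kroneckerPairing_cupProduct_eq_zero` (Thom's isotropy via
Čech–Alexander duality, `TubeComplementDuality.lean`) `x = a ⌢ y` with `⟨a ⌣ a, y⟩ = 0`; transported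
to `Sᵏ × Sᵏ` (`tubeRetraction`, a homeomorphism `A ≅ Sᵏ × (B ∖ 0)`), the cohomology ring
`Hᵏ(Sᵏ × Sᵏ) = ℤg₀ ⊕ ℤg₁`, `gᵢ ⌣ gᵢ = 0`, `g₁ ⌣ g₀ = g₀ ⌣ g₁` (`k` even; `SphereProductCohomology`,
`cupProduct_gradedComm_holds`) turns `⟨a ⌣ a, y⟩ = 0`, `a ⌢ y = m y₀ − m' y₁` into `m m' = 0`
(`SphereProd.mul_eq_zero_of_capProduct_eq`: with `a = p g₀ + q g₁`, `u = ⟨g₀ ⌣ g₁, y⟩`: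
`m = q u`, `-m' = p u`, `0 = ⟨a ⌣ a, y⟩ = 2 p q u`).

## References

* M. Kervaire, J. Milnor, *Groups of homotopy spheres I*, Ann. of Math. (2) 77 (1963), Lemma 5.8
  (p. 516; its printed proof, via Lemma 5.9, pp. 517–518), Lemma 5.6 (p. 514: `M₀`).
  doi:10.2307/1970128 [KervaireMilnorAnnals1963]
* R. Thom, *Espaces fibrés en sphères et carrés de Steenrod*, Ann. Sci. ENS 69 (1952), Thm. V.7,
  Thm. V.10. [Thom1952]
* A. Hatcher, *Algebraic Topology*, CUP 2002, Example 3.11, Thm. 3.11, §3.3 p. 241. [HatcherAT2002]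
-/

noncomputable section

open scoped Manifold ContDiff Topology ContinuousMap unitInterval
open Set Function Metric Topology CategoryTheory CategoryTheory.Limits AddSubgroup
open Literature.AlgebraicTopology.SingularHomology

namespace Literature.Topology.FourManifolds

/-! ### The algebra of `Hᵏ(Sᵏ × Sᵏ)`: an isotropic cap product has `m n = 0` -/

namespace SphereProd

variable {k : ℕ}

/-- **On `Sᵏ × Sᵏ` (`k ≥ 2` even): if `x = a ⌢ w = m y₀ + n y₁` with `⟨a ⌣ a, w⟩ = 0`, then
`m n = 0`.** With `a = p g₀ + q g₁` (a class of `Hᵏ(Sᵏ × Sᵏ; ℤ)` is determined by its values on the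
factors, `injective_evalH`), `gᵢ ⌣ gᵢ = 0`, `g₁ ⌣ g₀ = g₀ ⌣ g₁` (graded commutativity, `k` even) and
`u = ⟨g₀ ⌣ g₁, w⟩`: `m = ⟨g₀, a ⌢ w⟩ = ⟨a ⌣ g₀, w⟩ = q u`, `n = p u`, and
`0 = ⟨a ⌣ a, w⟩ = 2 p q u`, so `m n = p q u² = 0` (the self-intersection of the torus class
`m ε + n ε'` is `± 2 m n`, and it vanishes for a class isotropic in the sense of Thom 1952, Thm. V.10).
[cite: HatcherAT2002, Example 3.11, Thm. 3.11 and §3.3 p. 241] [cite: Thom1952, Thm. V.10 (p. 176)] -/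
theorem mul_eq_zero_of_capProduct_eq (hk : 2 ≤ k) (hke : Even k)
    (a : singularCohomology ℤ ℤ ((Metric.sphere (0 : EuclideanSpace ℝ (Fin (k + 1))) 1) ×
      (Metric.sphere (0 : EuclideanSpace ℝ (Fin (k + 1))) 1)) k)
    (w : singularHomology ℤ ℤ ((Metric.sphere (0 : EuclideanSpace ℝ (Fin (k + 1))) 1) ×
      (Metric.sphere (0 : EuclideanSpace ℝ (Fin (k + 1))) 1)) (k + k)) (m n : ℤ)
    (hx : capProduct (M := ℤ) (rfl : k + k = k + k) a w = m • y hk 0 + n • y hk 1)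
    (haa : kroneckerPairing ℤ ℤ _ (k + k) (cupProduct (rfl : k + k = k + k) a a) w = 0) :
    m * n = 0 := by
  set p : ℤ := kroneckerPairing ℤ ℤ _ k a (y hk 0) with hp
  set q : ℤ := kroneckerPairing ℤ ℤ _ k a (y hk 1) with hq
  set u : ℤ := kroneckerPairing ℤ ℤ _ (k + k) (cupProduct (rfl : k + k = k + k) (g hk 0) (g hk 1)) w
    with hu
  -- `a = p g₀ + q g₁`
  have ha : a = p • g hk 0 + q • g hk 1 := by
    apply injective_evalH hk
    funext b
    simp only [evalH, LinearMap.pi_apply, map_add, map_zsmul]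
    simp only [LinearMap.flip_apply, kroneckerPairing_g_y]
    fin_cases b <;> simp [hp, hq]
  -- `m = ⟨g₀, x⟩ = ⟨a ⌣ g₀, w⟩`, `n = ⟨g₁, x⟩ = ⟨a ⌣ g₁, w⟩`
  have hm : kroneckerPairing ℤ ℤ _ (k + k) (cupProduct (rfl : k + k = k + k) a (g hk 0)) w = m := by
    rw [kroneckerPairing_cupProduct, hx, map_add, map_zsmul, map_zsmul, kroneckerPairing_g_y_self,
      kroneckerPairing_g_y_of_ne hk (show (0 : Fin 2) ≠ 1 by decide)]
    simp
  have hn : kroneckerPairing ℤ ℤ _ (k + k) (cupProduct (rfl : k + k = k + k) a (g hk 1)) w = n := by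
    rw [kroneckerPairing_cupProduct, hx, map_add, map_zsmul, map_zsmul, kroneckerPairing_g_y_self,
      kroneckerPairing_g_y_of_ne hk (show (1 : Fin 2) ≠ 0 by decide)]
    simp
  -- `⟨c ⌣ d, w⟩` is symmetric (`k` even, graded commutativity)
  have hcomm : ∀ c d : singularCohomology ℤ ℤ _ k,
      kroneckerPairing ℤ ℤ _ (k + k) (cupProduct (rfl : k + k = k + k) c d) w =
        kroneckerPairing ℤ ℤ _ (k + k) (cupProduct (rfl : k + k = k + k) d c) w := by
    intro c d
    rw [cupProduct_gradedComm_holds ℤ _ rfl rfl c d, (kroneckerPairing ℤ ℤ _ (k + k)).map_smul,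
      LinearMap.smul_apply, smul_eq_mul, Even.neg_one_pow (hke.mul_right k), one_mul]
  -- bilinear expansion of `⟨c ⌣ d, w⟩` in either slot along `a = p g₀ + q g₁`
  have hR : ∀ c : singularCohomology ℤ ℤ _ k,
      kroneckerPairing ℤ ℤ _ (k + k) (cupProduct (rfl : k + k = k + k) c a) w =
        p * kroneckerPairing ℤ ℤ _ (k + k) (cupProduct (rfl : k + k = k + k) c (g hk 0)) w +
          q * kroneckerPairing ℤ ℤ _ (k + k) (cupProduct (rfl : k + k = k + k) c (g hk 1)) w := by
    intro c
    let L : singularCohomology ℤ ℤ _ k →ₗ[ℤ] ℤ :=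
      ((kroneckerPairing ℤ ℤ _ (k + k)).flip w) ∘ₗ (cupProduct (rfl : k + k = k + k) c)
    have hLapp : ∀ d, kroneckerPairing ℤ ℤ _ (k + k) (cupProduct (rfl : k + k = k + k) c d) w = L d :=
      fun d => rfl
    rw [hLapp, hLapp, hLapp]
    conv_lhs => rw [ha]
    rw [map_add, map_zsmul, map_zsmul, zsmul_eq_mul, zsmul_eq_mul, Int.cast_id, Int.cast_id]
  have hL : ∀ d : singularCohomology ℤ ℤ _ k,
      kroneckerPairing ℤ ℤ _ (k + k) (cupProduct (rfl : k + k = k + k) a d) w =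
        p * kroneckerPairing ℤ ℤ _ (k + k) (cupProduct (rfl : k + k = k + k) (g hk 0) d) w +
          q * kroneckerPairing ℤ ℤ _ (k + k) (cupProduct (rfl : k + k = k + k) (g hk 1) d) w := by
    intro d
    rw [hcomm a d, hR d, hcomm d (g hk 0), hcomm d (g hk 1)]
  -- the values on the generators
  have h00 : kroneckerPairing ℤ ℤ _ (k + k) (cupProduct (rfl : k + k = k + k) (g hk 0) (g hk 0)) w = 0 := by
    rw [cupProduct_g_self hk 0, map_zero, LinearMap.zero_apply]
  have h11 : kroneckerPairing ℤ ℤ _ (k + k) (cupProduct (rfl : k + k = k + k) (g hk 1) (g hk 1)) w = 0 := by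
    rw [cupProduct_g_self hk 1, map_zero, LinearMap.zero_apply]
  have h10 : kroneckerPairing ℤ ℤ _ (k + k) (cupProduct (rfl : k + k = k + k) (g hk 1) (g hk 0)) w = u :=
    hcomm _ _
  -- the numerical identities
  have hmq : m = q * u := by rw [← hm, hL, h00, h10]; ring
  have hnp : n = p * u := by rw [← hn, hL, h11, ← hu]; ring
  have h2 : p * (q * u) + q * (p * u) = 0 := by
    have h := haa
    rw [hL, hR, hR, h00, h10, h11, ← hu] at h
    linear_combination h
  have hpqu : p * q * u = 0 := by linarith
  calc m * n = p * q * u * u := by rw [hmq, hnp]; ring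
    _ = 0 := by rw [hpqu, zero_mul]

/-- The base point at which parallel and meridian are compared: `¼ s`, `s` the south pole. [folklore] -/
theorem quarter_southPole_ne_zero :
    (2⁻¹ : ℝ) • (2⁻¹ : ℝ) • ((southPole k : Metric.sphere (0 : EuclideanSpace ℝ (Fin (k + 1))) 1) :
      EuclideanSpace ℝ (Fin (k + 1))) ≠ 0 :=
  smul_ne_zero (by norm_num) (smul_ne_zero (by norm_num) (ne_zero_of_mem_unit_sphere _))

/-- `‖¼ s‖ < 1`. [folklore] -/
theorem norm_quarter_southPole_lt_one :
    ‖(2⁻¹ : ℝ) • (2⁻¹ : ℝ) • ((southPole k : Metric.sphere (0 : EuclideanSpace ℝ (Fin (k + 1))) 1) :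
      EuclideanSpace ℝ (Fin (k + 1)))‖ < 1 := by
  rw [norm_smul, norm_smul, norm_eq_of_mem_sphere]
  norm_num

end SphereProd

/-! ### Transport of an isotropic cap product along a homology isomorphism -/

/-- If `Ψ : P → Y` is injective on `Hₖ` and onto on `H₂ₖ`, an isotropic cap-product presentation
`Ψ⁎x' = a ⌢ y`, `⟨a ⌣ a, y⟩ = 0` in `Y` pulls back to one of `x'` in `P` (naturality of cap, cup and
Kronecker pairing). [cite: HatcherAT2002, §3.3 p. 241] -/
theorem exists_capProduct_eq_of_map {P Y : Type} [TopologicalSpace P] [TopologicalSpace Y] {k : ℕ}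
    (Ψ : C(P, Y)) (hinj : Function.Injective (singularHomology.map ℤ ℤ Ψ k))
    (hsurj : Function.Surjective (singularHomology.map ℤ ℤ Ψ (k + k)))
    (x' : singularHomology ℤ ℤ P k) {a : singularCohomology ℤ ℤ Y k}
    {yy : singularHomology ℤ ℤ Y (k + k)}
    (h1 : capProduct (M := ℤ) (rfl : k + k = k + k) a yy = singularHomology.map ℤ ℤ Ψ k x')
    (h2 : kroneckerPairing ℤ ℤ Y (k + k) (cupProduct (rfl : k + k = k + k) a a) yy = 0) :
    ∃ (a' : singularCohomology ℤ ℤ P k) (w : singularHomology ℤ ℤ P (k + k)),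
      capProduct (M := ℤ) (rfl : k + k = k + k) a' w = x' ∧
        kroneckerPairing ℤ ℤ P (k + k) (cupProduct (rfl : k + k = k + k) a' a') w = 0 := by
  obtain ⟨w, rfl⟩ := hsurj yy
  refine ⟨singularCohomology.map ℤ ℤ Ψ k a, w, hinj ?_, ?_⟩
  · rw [capProduct_map, h1]
  · rw [← cupProduct_map, kroneckerPairing_map, h2]

/-! ### `(ISO)` for a framed sphere in the middle dimension, `k` even -/

namespace FramedSphereFamily

open ExtCollar

variable {k m : ℕ} {W' : Type} [TopologicalSpace W'] [ChartedSpace (EuclideanHalfSpace (m + 1)) W']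
  (ν' : FramedSphereFamily (𝓡∂ (m + 1)) W' Unit k (k + 1))

set_option maxHeartbeats 800000 in
/-- **`(ISO)` — the isotropy of the torus of a spherical modification** (the parity input of
Kervaire–Milnor's Lemma 5.8, p. 516, obtained through Thom's isotropy theorem for `M₀` (Lemma 5.6,
p. 514) instead of the semi-characteristic of Lemma 5.9). Let `W` be a compact, simply connected
smooth `(2k+1)`-manifold with boundary, `k ≥ 2` even, with `Hᵏ(∂W; ℤ) = 0` (e.g. `∂W` a homology
sphere, Hypothesis p. 516), `φ : Sᵏ × ℝᵏ⁺¹ ↪ W` a framed sphere with core `S`, `θ` a generator of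
`Hₖ(Sᵏ; ℤ)`, `ε = φ(· , v₀)` the parallel (`v₀ = s/4`) and `ε' = φ(s, ·/2)` the meridian in
`W ∖ S` (`s` the south pole). **If `m ε⁎θ = m' ε'⁎θ` in `Hₖ(W ∖ S; ℤ)`, then `m m' = 0`.** Proof:
in `X = ExtCollar W ∖ incl S` the class `x = m ε⁎θ − m' ε'⁎θ`, carried by the punctured half-tube
`A ≅ Sᵏ × (½B ∖ 0) ≃ Sᵏ × Sᵏ`, dies; by Thom's isotropy
(`exists_eq_capProduct_and_kroneckerPairing_cupProduct_eq_zero`) `x = a ⌢ y`, `⟨a ⌣ a, y⟩ = 0`,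
and on `Sᵏ × Sᵏ` this forces `m m' = 0` (`SphereProd.mul_eq_zero_of_capProduct_eq`).
[cite: KervaireMilnorAnnals1963, Lemma 5.6 (p. 514: M₀, and p. 516: ε, ε') and Lemma 5.8 (p. 516)] [cite: Thom1952, Thm. V.7 and Thm. V.10] -/
theorem mul_eq_zero_of_zsmul_parallel_eq_zsmul_meridian [T2Space W'] [CompactSpace W']
    [IsManifold (𝓡∂ (m + 1)) ∞ W'] [SimplyConnectedSpace W'] (hkm : k + k = m) (hk : 2 ≤ k)
    (hke : Even k) (hbd : IsZero (singularCohomology ℤ ℤ ↥((𝓡∂ (m + 1)).boundary W') k))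
    {θ : singularHomology ℤ ℤ (Metric.sphere (0 : EuclideanSpace ℝ (Fin (k + 1))) 1) k}
    (hθ : zmultiples θ = ⊤) (m₁ m₂ : ℤ)
    (hrel : m₁ • singularHomology.map ℤ ℤ (ν'.parallelSphere SphereProd.quarter_southPole_ne_zero) k θ =
      m₂ • singularHomology.map ℤ ℤ
        (ν'.tubeIncl.comp (FramedSphereFamily.meridianPT (SphereProd.southPole k))) k θ) :
    m₁ * m₂ = 0 := by
  subst hkm
  -- the spaces `X = ExtCollar W ∖ incl S ⊇ A` (punctured half-tube) and `P = Sᵏ × Sᵏ`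
  let φ := ν'.toFun ()
  let S' : Set (ExtCollar (k + k) W') := incl (k + k) '' ν'.cores
  let A : Set ↥(S'ᶜ) := {p | base (p : ExtCollar (k + k) W') ∈ ν'.halfTubes}
  have hφc : Continuous φ := ν'.continuous ()
  -- membership lemmas
  have hmemX : ∀ (u : Metric.sphere (0 : EuclideanSpace ℝ (Fin (k + 1))) 1)
      (v : EuclideanSpace ℝ (Fin (k + 1))), v ≠ 0 → incl (k + k) (φ (u, v)) ∈ S'ᶜ := by
    rintro u v hv ⟨w, hw, he⟩
    rw [incl_injective he] at hw
    exact hv ((ν'.apply_mem_cores_iff () (u := u) (w := v)).1 hw)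
  have hmemA : ∀ (u : Metric.sphere (0 : EuclideanSpace ℝ (Fin (k + 1))) 1)
      (v : EuclideanSpace ℝ (Fin (k + 1))) (hv : v ≠ 0), ‖v‖ < 2⁻¹ →
        (⟨incl (k + k) (φ (u, v)), hmemX u v hv⟩ : ↥(S'ᶜ)) ∈ A := by
    intro u v hv hn
    show base (incl (k + k) (φ (u, v))) ∈ ν'.halfTubes
    rw [show base (incl (k + k) (φ (u, v))) = φ (u, v) from rfl, ν'.apply_mem_halfTubes_iff]
    exact hn
  -- the parametrisation `E : Sᵏ × (B ∖ 0) → A`, `(u, v) ↦ incl φ(u, v/2)`, a homeomorphism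
  have hhalf : ∀ q : ↥(puncturedUnitTube k k), (2⁻¹ : ℝ) • q.1.2 ≠ 0 := fun q =>
    smul_ne_zero (by norm_num) q.2.1
  have hhalf' : ∀ q : ↥(puncturedUnitTube k k), ‖(2⁻¹ : ℝ) • q.1.2‖ < 2⁻¹ := fun q => by
    rw [norm_smul, Real.norm_of_nonneg (by norm_num : (0 : ℝ) ≤ 2⁻¹)]
    have := q.2.2
    nlinarith [norm_nonneg q.1.2]
  let E : ↥(puncturedUnitTube k k) → ↥A := fun q =>
    ⟨⟨incl (k + k) (φ (q.1.1, (2⁻¹ : ℝ) • q.1.2)), hmemX _ _ (hhalf q)⟩, hmemA _ _ (hhalf q) (hhalf' q)⟩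
  have hEval : ∀ q, (((E q : ↥A) : ↥(S'ᶜ)) : ExtCollar (k + k) W') =
      incl (k + k) (φ (q.1.1, (2⁻¹ : ℝ) • q.1.2)) := fun q => rfl
  have hEemb : IsEmbedding E := by
    let sc : ((Metric.sphere (0 : EuclideanSpace ℝ (Fin (k + 1))) 1) × EuclideanSpace ℝ (Fin (k + 1))) ≃ₜ
        ((Metric.sphere (0 : EuclideanSpace ℝ (Fin (k + 1))) 1) × EuclideanSpace ℝ (Fin (k + 1))) :=
      (Homeomorph.refl _).prodCongr (Homeomorph.smulOfNeZero (2⁻¹ : ℝ) (by norm_num))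
    have hpo : IsOpen (puncturedUnitTube k k) :=
      (isOpen_compl_singleton.preimage continuous_snd).inter
        (isOpen_lt (continuous_norm.comp continuous_snd) continuous_const)
    have h1 : IsEmbedding ((incl (k + k) ∘ φ) ∘ sc ∘ (Subtype.val : ↥(puncturedUnitTube k k) → _)) :=
      (ν'.isOpenEmbedding_incl_comp_toFun rfl).isEmbedding.comp
        (sc.isEmbedding.comp IsEmbedding.subtypeVal)
    have h2 : (incl (k + k) ∘ φ) ∘ sc ∘ (Subtype.val : ↥(puncturedUnitTube k k) → _) =
        Subtype.val ∘ Subtype.val ∘ E := by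
      funext q
      rfl
    rw [h2] at h1
    exact (IsEmbedding.of_comp_iff IsEmbedding.subtypeVal).1
      ((IsEmbedding.of_comp_iff IsEmbedding.subtypeVal).1 h1)
  have hEsurj : Surjective E := by
    intro p
    have hb : base ((p : ↥(S'ᶜ)) : ExtCollar (k + k) W') ∈ ν'.halfTubes := p.2
    simp only [FramedSphereFamily.halfTubes, mem_iUnion, mem_image, mem_setOf_eq] at hb
    obtain ⟨i, q, hq, hqe⟩ := hb
    obtain rfl : i = () := Subsingleton.elim _ _
    have hh : height ((p : ↥(S'ᶜ)) : ExtCollar (k + k) W') = 0 :=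
      height_eq_zero_of_base_not_mem (by rw [← hqe]; exact ν'.apply_not_mem_boundary rfl () q)
    have hp : ((p : ↥(S'ᶜ)) : ExtCollar (k + k) W') = incl (k + k) (φ q) := by
      rw [← incl_base_of_height_eq_zero hh]
      exact congrArg (incl (k + k)) hqe.symm
    have hq0 : q.2 ≠ 0 := by
      intro h0
      apply (p : ↥(S'ᶜ)).2
      refine ⟨φ q, ?_, hp.symm⟩
      rw [show q = (q.1, 0) from Prod.ext rfl h0]
      exact ν'.sphere_mem_cores () q.1
    have hq1 : ‖(2 : ℝ) • q.2‖ < 1 := by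
      rw [norm_smul, Real.norm_of_nonneg (by norm_num : (0 : ℝ) ≤ 2)]
      have : ‖q.2‖ < 2⁻¹ := hq
      linarith
    refine ⟨⟨(q.1, (2 : ℝ) • q.2), ⟨smul_ne_zero (by norm_num) hq0, hq1⟩⟩, ?_⟩
    apply Subtype.ext; apply Subtype.ext
    rw [hEval, hp, smul_smul]
    norm_num
  let Φ : ↥(puncturedUnitTube k k) ≃ₜ ↥A := hEemb.toHomeomorphOfSurjective hEsurj
  have hΦ : ∀ q, Φ q = E q := fun q => IsEmbedding.toHomeomorphOfSurjective_apply _ _ q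
  -- `Ψ = Φ ∘ (u, w) ↦ (u, w/2) : Sᵏ × Sᵏ → A` is a homology isomorphism
  let Ψ : C((Metric.sphere (0 : EuclideanSpace ℝ (Fin (k + 1))) 1) ×
      (Metric.sphere (0 : EuclideanSpace ℝ (Fin (k + 1))) 1), ↥A) :=
    (Φ : C(↥(puncturedUnitTube k k), ↥A)).comp (tubeSection k k)
  have hΨval : ∀ pt, (((Ψ pt : ↥A) : ↥(S'ᶜ)) : ExtCollar (k + k) W') =
      incl (k + k) (φ (pt.1, (2⁻¹ : ℝ) • (2⁻¹ : ℝ) • (pt.2 : EuclideanSpace ℝ (Fin (k + 1))))) := by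
    intro pt
    show (((Φ (tubeSection k k pt) : ↥A) : ↥(S'ᶜ)) : ExtCollar (k + k) W') = _
    rw [hΦ, hEval]
    rfl
  have hΨiso : ∀ j, IsIso (singularHomology.map ℤ ℤ Ψ j) := by
    intro j
    have h1 : IsIso (singularHomology.map ℤ ℤ (tubeSection k k) j) :=
      isIso_map_homotopyEquiv_toFun (tubeRetraction k k).symm j
    have h2 : IsIso (singularHomology.map ℤ ℤ (Φ : C(↥(puncturedUnitTube k k), ↥A)) j) :=
      isIso_map_homotopyEquiv_toFun Φ.toHomotopyEquiv j
    rw [show Ψ = (Φ : C(↥(puncturedUnitTube k k), ↥A)).comp (tubeSection k k) from rfl,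
      singularHomology.map_comp]
    infer_instance
  have hΨbij : ∀ j, Bijective (singularHomology.map ℤ ℤ Ψ j) := fun j =>
    (ConcreteCategory.isIso_iff_bijective _).1 (hΨiso j)
  -- the inclusion `W ∖ S → X`
  have hjXmem : ∀ c : ↥ν'.complement, incl (k + k) (c : W') ∈ S'ᶜ := by
    rintro c ⟨w, hw, he⟩
    exact c.2 (incl_injective he ▸ hw)
  let jX : C(↥ν'.complement, ↥(S'ᶜ)) :=
    ⟨fun c => ⟨incl (k + k) (c : W'), hjXmem c⟩,
      (continuous_incl.comp continuous_subtype_val).subtype_mk hjXmem⟩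
  -- parallel: `jX ∘ ε = val ∘ Ψ ∘ ι₁` on the nose
  have hpar : jX.comp (ν'.parallelSphere SphereProd.quarter_southPole_ne_zero) =
      (subsetIncl A).comp (Ψ.comp (SphereProd.ι₁ k)) := by
    refine ContinuousMap.ext fun u => Subtype.ext ?_
    exact (hΨval (u, SphereProd.southPole k)).symm
  -- meridian: `jX ∘ ε'` (radius `½`) is homotopic to `val ∘ Ψ ∘ ι₂` (radius `¼`) in `X`
  have hmer : (jX.comp (ν'.tubeIncl.comp (FramedSphereFamily.meridianPT (SphereProd.southPole k)))).Homotopic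
      ((subsetIncl A).comp (Ψ.comp (SphereProd.ι₂ k))) := by
    have hc : ∀ t : I, (0 : ℝ) < 2⁻¹ - 4⁻¹ * (t : ℝ) := fun t => by
      have := t.2.2
      linarith
    have hcont : Continuous fun p : I × (Metric.sphere (0 : EuclideanSpace ℝ (Fin (k + 1))) 1) =>
        incl (k + k) (φ (SphereProd.southPole k,
          ((2⁻¹ : ℝ) - 4⁻¹ * (p.1 : ℝ)) • (p.2 : EuclideanSpace ℝ (Fin (k + 1))))) := by
      refine continuous_incl.comp (hφc.comp (continuous_const.prodMk ?_))
      fun_prop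
    refine ⟨{ toFun := fun p => ⟨incl (k + k) (φ (SphereProd.southPole k,
                  ((2⁻¹ : ℝ) - 4⁻¹ * (p.1 : ℝ)) • (p.2 : EuclideanSpace ℝ (Fin (k + 1))))),
                hmemX _ _ (smul_ne_zero (hc p.1).ne' (ne_zero_of_mem_unit_sphere p.2))⟩,
              continuous_toFun := hcont.subtype_mk _,
              map_zero_left := fun w => ?_,
              map_one_left := fun w => ?_ }⟩
    · apply Subtype.ext
      show incl (k + k) (φ (SphereProd.southPole k, ((2⁻¹ : ℝ) - 4⁻¹ * ((0 : I) : ℝ)) • (w : _))) =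
        incl (k + k) (φ (SphereProd.southPole k, (2⁻¹ : ℝ) • (w : EuclideanSpace ℝ (Fin (k + 1)))))
      norm_num
    · apply Subtype.ext
      rw [ContinuousMap.comp_apply, ContinuousMap.comp_apply]
      show incl (k + k) (φ (SphereProd.southPole k, ((2⁻¹ : ℝ) - 4⁻¹ * ((1 : I) : ℝ)) • (w : _))) =
        (((Ψ (SphereProd.ι₂ k w) : ↥A) : ↥(S'ᶜ)) : ExtCollar (k + k) W')
      rw [hΨval]
      show incl (k + k) (φ (SphereProd.southPole k, ((2⁻¹ : ℝ) - 4⁻¹ * ((1 : I) : ℝ)) • (w : _))) =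
        incl (k + k) (φ (SphereProd.southPole k, (2⁻¹ : ℝ) • (2⁻¹ : ℝ) • (w : EuclideanSpace ℝ (Fin (k + 1)))))
      rw [smul_smul]
      norm_num
  -- the class `x' = m₁ ι₁⁎θ − m₂ ι₂⁎θ` on `Sᵏ × Sᵏ` and its image `x` in `Hₖ(A)`, which dies in `X`
  set x' : singularHomology ℤ ℤ ((Metric.sphere (0 : EuclideanSpace ℝ (Fin (k + 1))) 1) ×
      (Metric.sphere (0 : EuclideanSpace ℝ (Fin (k + 1))) 1)) k :=
    m₁ • singularHomology.map ℤ ℤ (SphereProd.ι₁ k) k θ -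
      m₂ • singularHomology.map ℤ ℤ (SphereProd.ι₂ k) k θ with hx'
  have hx0 : singularHomology.map ℤ ℤ (subsetIncl A) k (singularHomology.map ℤ ℤ Ψ k x') = 0 := by
    have e1 : singularHomology.map ℤ ℤ (subsetIncl A) k
        (singularHomology.map ℤ ℤ Ψ k (singularHomology.map ℤ ℤ (SphereProd.ι₁ k) k θ)) =
        singularHomology.map ℤ ℤ jX k
          (singularHomology.map ℤ ℤ (ν'.parallelSphere SphereProd.quarter_southPole_ne_zero) k θ) := by
      rw [← ModuleCat.comp_apply, ← singularHomology.map_comp, ← ModuleCat.comp_apply,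
        ← singularHomology.map_comp, ← ModuleCat.comp_apply, ← singularHomology.map_comp, hpar]
      rfl
    have e2 : singularHomology.map ℤ ℤ (subsetIncl A) k
        (singularHomology.map ℤ ℤ Ψ k (singularHomology.map ℤ ℤ (SphereProd.ι₂ k) k θ)) =
        singularHomology.map ℤ ℤ jX k (singularHomology.map ℤ ℤ
          (ν'.tubeIncl.comp (FramedSphereFamily.meridianPT (SphereProd.southPole k))) k θ) := by
      rw [← ModuleCat.comp_apply, ← singularHomology.map_comp, ← ModuleCat.comp_apply,
        ← singularHomology.map_comp, ← ModuleCat.comp_apply, ← singularHomology.map_comp,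
        singularHomology.map_eq_of_homotopic ℤ ℤ hmer k]
      rfl
    have hrel' := congrArg (singularHomology.map ℤ ℤ jX k) hrel
    rw [map_zsmul, map_zsmul] at hrel'
    rw [hx', map_sub, map_zsmul, map_zsmul, map_sub, map_zsmul, map_zsmul, e1, e2, hrel', sub_self]
  -- Thom's isotropy in `A`, transported to `Sᵏ × Sᵏ`
  obtain ⟨a, yy, h1, h2⟩ :=
    ν'.exists_eq_capProduct_and_kroneckerPairing_cupProduct_eq_zero rfl hk hbd
      (singularHomology.map ℤ ℤ Ψ k x') hx0
  obtain ⟨a', w, h1', h2'⟩ :=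
    exists_capProduct_eq_of_map Ψ (hΨbij k).1 (hΨbij (k + k)).2 x' h1 h2
  -- `θ = c [Sᵏ]`, `c ≠ 0`, and `x' = (m₁ c) y₀ + (−m₂ c) y₁`
  obtain ⟨c, hc⟩ := SphereProd.exists_eq_smul_fundamentalClass_sphere hk θ
  have hc0 : c ≠ 0 := by
    rintro rfl
    rw [zero_smul] at hc
    have h := eq_zero_of_zsmul_generator_eq_zero (k := k) (by omega) hθ (c := 1)
      (by rw [hc, one_zsmul])
    exact one_ne_zero h
  have hx'y : x' = (m₁ * c) • SphereProd.y hk 0 + (-(m₂ * c)) • SphereProd.y hk 1 := by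
    rw [hx', hc, map_zsmul, map_zsmul, smul_smul, smul_smul, neg_zsmul, ← sub_eq_add_neg]
    rfl
  have hG := SphereProd.mul_eq_zero_of_capProduct_eq hk hke a' w (m₁ * c) (-(m₂ * c))
    (h1'.trans hx'y) h2'
  have h3 : m₁ * m₂ * (c * c) = 0 := by linear_combination -hG
  exact (mul_eq_zero.1 h3).resolve_right (mul_ne_zero hc0 hc0)

end FramedSphereFamily

end Literature.Topology.FourManifolds

end
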